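import Summits.BirchSwinnertonDyer.BirchSwinnertonDyer.Theorems.EdixhovenFibreFiveSevenTwistDegreeStepOrdinaryLeverAtSymbols
import Summits.BirchSwinnertonDyer.BirchSwinnertonDyer.Theorems.AdditiveKolyvaginRoadManinFrameResidueProperRTameTwistFull
import HarnessLib

/-!
# The FULL tame-twist lever (`p > 7`) RE-KEYED PER CLASS, III: Manin's `p`-part at a lattice-optimal datum, a Manin-unit
# member, and the twist-degree step TDS at every frame — from the body of Kato's fact at the members of ONE isogeny class

HONEST FRAMING. TOOL theorems only (no definition, no named fact, no `sorry`); nothing is closed or booked; BSD is not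
proved by any of this. Seat `bsd-line-edix-p4` g9 (route `EdixhovenFibreFiveSeven`; cruxes K★ 22226 / TDS11 22228; line `kato-lever`,
lane (g) = memo `Cruxes/StarredOptimalManinUnitFiveSeven/Lines/kato-lever-hDR-programme.md` v3.1 §3 (g)).

WHY. The FULL tame-twist lever of seat bsd-wall-manin-p1 g3 (`ManinFrameResidueProperRTameTwist.*L`, files
`AdditiveKolyvaginRoadManinFrameResidueProperRTameTwist{FullCharacter,FullSymbols,Full}`) takes the UNIVERSAL cite-only fact F
`kato_neron_isIntegral_twistedSymbolSum_of_additive` (`p > 7` reading; binder `hK`) but APPLIES it only at the curve under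
discussion (`hK W f hf p …`), resp. at the `X₀(N)`-optimal member of the frame's isogeny class. The per-class assembly
`KatoAssemblySocketAt.katoNeronBody_of_sl2NeronValues_of_isDeRhamAt` (file `…AssemblyAt`) proves that instance from
P1 ∧ (S5b-tower) ∧ Prop. 1.2.3 ∧ de Rham-ness of `V_p|_{Γ_{ℚ_p}}` of ONE member — a tree theorem for (G)-ordinary classes.
These files re-key the lever on the PER-CURVE hypothesis `hK : <body of F at (W, p)>` (resp. PER-CLASS: the body at every
`W₀ ∼ W`); every proof is the parent's VERBATIM with `hK W f hf p` ↦ `hK f hf` (and the `_at` names).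

* `not_dvd_c_of_tameTwistL_at` (per curve), `exists_member_not_dvd_c_of_tameTwistL_at`, `twistDegreeStep_of_tameTwistL_at`
  (per class: the body of Kato's fact at every globally minimal `W₀ ∼ W`) — the parents (p573163 lineage) re-keyed.

References: [Kato2004Asterisque] (8.1.3) p. 180, Thm. 9.7 p. 189; [KimNakamura2020] Cor. 2.4; [EdixhovenManin1991] §4;
[Manin1972] Thm. 1.6; parent files' module docstrings for the full derivations.
-/

set_option autoImplicit false
-- the Theorems namespace of a single-conjunct summit repeats the summit name by design (D-0017)
set_option linter.dupNamespace false

noncomputable section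

open scoped Classical MatrixGroups

open WeierstrassCurve NumberField Literature.NumberTheory.EllipticCurves
  Literature.NumberTheory.EllipticCurves.ModularForms
  Literature.NumberTheory.EllipticCurves.Rank1Residual
  Literature.NumberTheory.DiophantineGeometry IsDedekindDomain Rat.HeightOneSpectrum
  Summit.BirchSwinnertonDyer.Rank1Residual Summit.BirchSwinnertonDyer.Rank1Residual.Additive
  CongruenceSubgroup Complex
  Summit.BirchSwinnertonDyer.BirchSwinnertonDyer.Theorems.ManinFrameResidueProperRTameTwist

namespace Summit.BirchSwinnertonDyer.BirchSwinnertonDyer.Theorems.ManinFrameResidueProperRTameTwistAt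

section MainFull

variable {p : ℕ} [hp : Fact p.Prime]

/-- **Manin's `p`-part at a lattice-optimal datum, from the tame-twist lever.** Let `W/ℚ` be globally
minimal, additive at a prime `p > 7` with `E[p]` irreducible, `D` a LATTICE-OPTIMAL datum
(`Λ_E = c Λ_f`) at a level `N` with `p² ∣ N`, with `a_ℓ(W) = ±1` for every `ℓ ∥ N` (multiplicative primes) — NO further hypothesis on `(N, a_ℓ)`. GRANTED the all-characters Kato–Kosters–Pannekoek fact: `p ∤ c`.
Proof: `im Λ_f = ℤ·Ω⁻_f/2` is generated by the `Im {∞, γ∞}_f`, all in `ℤ_(p)|Ω⁻(W)|`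
(`pint_im_cuspSymbolL_at`), so `ord_p ϖ ≥ 0` for `ϖ |Ω⁻(W)| = Ω⁻_f`, while `ord_p ϖ = −ord_p c` at a
lattice-optimal datum. [cite: Kato2004Asterisque, (8.1.3) (p. 180), Thm. 9.7 (p. 189)]
[cite: KimNakamura2020, Cor. 2.4] [cite: EdixhovenManin1991, §1] -/
theorem not_dvd_c_of_tameTwistL_at (W : WeierstrassCurve ℚ) [W.IsElliptic] [W.IsGloballyMinimal] {N : ℕ} [NeZero N]
    (hK : ∀ {M : ℕ} [NeZero M] (g : CuspForm (Gamma0 M) 2), IsNewformOf W g → 7 < p →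
      ¬ W.HasGoodReductionAtPrime p → ¬ W.HasMultiplicativeReductionAtPrime p →
      W.HasIrreducibleModPGaloisRep p → ∀ (m : ℕ) [NeZero m], m.Coprime (p * M) →
      ∀ (χ : DirichletCharacter ℂ m), χ.IsPrimitive → χ ≠ 1 → ¬ p ∣ orderOf χ → ∀ (ϖ : ℚ) (r : ℂ),
      (χ.Even → (ϖ : ℝ) * W.realPeriodRat = plusPeriod g →
        (∏ ℓ ∈ M.primeFactors with ¬ ℓ ^ 2 ∣ M,
            (((ℓ : ℂ) - (W.LFunction ℓ : ℂ) * χ (ℓ : ZMod m)) *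
              ((ℓ : ℂ) - (W.LFunction ℓ : ℂ) * (χ (ℓ : ZMod m))⁻¹))) *
            twistedSymbolSum g χ = r * (plusPeriod g : ℂ) →
        ∃ s : ℕ, ¬ p ∣ s ∧ IsIntegral ℤ ((s : ℂ) * ϖ * r)) ∧
      (χ.Odd → (ϖ : ℝ) * W.imaginaryPeriodRat = minusPeriod g →
        (∏ ℓ ∈ M.primeFactors with ¬ ℓ ^ 2 ∣ M,
            (((ℓ : ℂ) - (W.LFunction ℓ : ℂ) * χ (ℓ : ZMod m)) *
              ((ℓ : ℂ) - (W.LFunction ℓ : ℂ) * (χ (ℓ : ZMod m))⁻¹))) *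
            twistedSymbolSum g χ = r * (minusPeriod g : ℂ) * Complex.I →
        ∃ s : ℕ, ¬ p ∣ s ∧ IsIntegral ℤ ((s : ℂ) * ϖ * r)))
    (D : ModularParametrizationData W N)
    (hopt : ∀ z ∈ D.L.lattice, ∃ w ∈ periodLattice D.f, z = D.c * w) (hp7 : 7 < p)
    (hadd : Addv W p) (hirr : Irr W p) (hpN : p ^ 2 ∣ N)
    (ha : ∀ ℓ ∈ N.primeFactors, ¬ ℓ ^ 2 ∣ N → W.LFunction ℓ = 1 ∨ W.LFunction ℓ = -1) :
    ¬ (p : ℤ) ∣ D.c := by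
  have hpP : p.Prime := hp.out
  have hp2 : p ≠ 2 := by omega
  have hc0 : D.c ≠ 0 := D.maninConstant_ne_zero_holds
  -- the period scalar `ϖ = m/|c|`
  obtain ⟨mm, -, hmm⟩ :=
    SkinnerUrban2014.exists_dvd_two_mul_imaginaryPeriodRat_eq_of_latticeEq D hopt
  set ϖ : ℚ := (mm : ℚ) / |(D.c : ℚ)| with hϖdef
  have habs0 : |(D.c : ℝ)| ≠ 0 := abs_ne_zero.mpr (by exact_mod_cast hc0)
  have hϖ : (ϖ : ℝ) * W.imaginaryPeriodRat = minusPeriod D.f := by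
    rw [hϖdef]; push_cast
    rw [div_mul_eq_mul_div, hmm]
    field_simp
  have hΩf : 0 < minusPeriod D.f :=
    IsNewform0.minusPeriod_pos_holds D.isNewformOf.1 D.isNewformOf.coeffField_eq_bot
  have hΩ : 0 < W.imaginaryPeriodRat := W.imaginaryPeriodRat_pos
  -- `Ω⁻_f/2 = Im {∞, γ∞}_f` for some `γ`
  have hmem : minusPeriod D.f / 2 ∈ imagPeriods D.f := by
    rw [SkinnerUrban2014.imagPeriods_eq_zmultiples_of_minusPeriod_pos D.f hΩf]
    exact AddSubgroup.mem_zmultiples _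
  obtain ⟨z, hz, hzim⟩ := AddSubgroup.mem_map.mp hmem
  have hz' : z ∈ (periodLattice D.f : Set ℂ) := hz
  rw [coe_periodLattice_eq_range] at hz'
  obtain ⟨γ, hγ⟩ := hz'
  have hP := pint_im_cuspSymbolL_at hK hp7 hadd hirr D.f D.isNewformOf hpN ha hϖ γ
  rw [hγ] at hP
  have hzim' : z.im = minusPeriod D.f / 2 := hzim
  -- `Im z / Ω = ϖ/2`
  have hq : (((z.im : ℝ) : ℂ) / (W.imaginaryPeriodRat : ℂ)) = ((ϖ / 2 : ℚ) : ℂ) := by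
    rw [hzim', ← hϖ]
    have hΩ0 : (W.imaginaryPeriodRat : ℂ) ≠ 0 := by exact_mod_cast hΩ.ne'
    push_cast
    field_simp
  rw [hq] at hP
  have hval := padicValRat_nonneg_of_pint hP
  have hϖ2 : padicValRat p (ϖ / 2) = padicValRat p ϖ := by
    have hϖ0 : ϖ ≠ 0 := by
      rintro h; rw [h, Rat.cast_zero, zero_mul] at hϖ; exact hΩf.ne' hϖ.symm
    rw [padicValRat.div hϖ0 two_ne_zero, show (2 : ℚ) = ((2 : ℕ) : ℚ) by norm_num, padicValRat.of_nat,
      padicValNat.eq_zero_of_not_dvd (fun h ↦ hp2 ((Nat.prime_dvd_prime_iff_eq hpP Nat.prime_two).mp h))]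
    simp
  rw [hϖ2, ManinFrameResidueProperRUnitTwist.padicValRat_eq_neg_of_mul_imaginaryPeriodRat_eq hp2 D hopt hϖ]
    at hval
  exact not_dvd_of_padicValRat_intCast_le_zero hc0 (by linarith)

/-- **At an AKR residue frame: a member with a Manin-unit conductor-level datum** (the member statement of
line `birth`), GRANTED the fact and modularity, at EVERY frame — `p ≥ 11`, additive, `E[p]` irreducible
(`a_ℓ = ±1` at `ℓ ∥ N(W)` by Kraus–Oesterlé, tree theorem): the
`X₀(N)`-optimal member (`X12.exists_isIsogenous_optimal`, lattice-optimal datum) has `p ∤ c₀` by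
`not_dvd_c_of_tameTwistL_at` (`N(W₀) = N(W)`, `a_ℓ(W₀) = a_ℓ(W)`). [cite: EdixhovenManin1991, §4 (cases 1/2)] -/
theorem exists_member_not_dvd_c_of_tameTwistL_at
    (hnf : exists_isNewformOf) (W : WeierstrassCurve ℚ) [W.IsElliptic] [W.IsGloballyMinimal]
    [NeZero (W.conductorNorm ℤ)] (hp11 : 11 ≤ p) (hadd : Addv W p) (hirr : Irr W p)
    (hK : ∀ (W₀ : WeierstrassCurve ℚ) [W₀.IsElliptic] [W₀.IsGloballyMinimal], IsIsogenous W W₀ →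
      ∀ {M : ℕ} [NeZero M] (g : CuspForm (Gamma0 M) 2), IsNewformOf W₀ g → 7 < p →
      ¬ W₀.HasGoodReductionAtPrime p → ¬ W₀.HasMultiplicativeReductionAtPrime p →
      W₀.HasIrreducibleModPGaloisRep p → ∀ (m : ℕ) [NeZero m], m.Coprime (p * M) →
      ∀ (χ : DirichletCharacter ℂ m), χ.IsPrimitive → χ ≠ 1 → ¬ p ∣ orderOf χ → ∀ (ϖ : ℚ) (r : ℂ),
      (χ.Even → (ϖ : ℝ) * W₀.realPeriodRat = plusPeriod g →
        (∏ ℓ ∈ M.primeFactors with ¬ ℓ ^ 2 ∣ M,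
            (((ℓ : ℂ) - (W₀.LFunction ℓ : ℂ) * χ (ℓ : ZMod m)) *
              ((ℓ : ℂ) - (W₀.LFunction ℓ : ℂ) * (χ (ℓ : ZMod m))⁻¹))) *
            twistedSymbolSum g χ = r * (plusPeriod g : ℂ) →
        ∃ s : ℕ, ¬ p ∣ s ∧ IsIntegral ℤ ((s : ℂ) * ϖ * r)) ∧
      (χ.Odd → (ϖ : ℝ) * W₀.imaginaryPeriodRat = minusPeriod g →
        (∏ ℓ ∈ M.primeFactors with ¬ ℓ ^ 2 ∣ M,
            (((ℓ : ℂ) - (W₀.LFunction ℓ : ℂ) * χ (ℓ : ZMod m)) *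
              ((ℓ : ℂ) - (W₀.LFunction ℓ : ℂ) * (χ (ℓ : ZMod m))⁻¹))) *
            twistedSymbolSum g χ = r * (minusPeriod g : ℂ) * Complex.I →
        ∃ s : ℕ, ¬ p ∣ s ∧ IsIntegral ℤ ((s : ℂ) * ϖ * r))) :
    ∃ (W₀ : WeierstrassCurve ℚ) (_ : W₀.IsElliptic) (_ : W₀.IsGloballyMinimal)
      (D₀ : ModularParametrizationData W₀ (W.conductorNorm ℤ)),
      IsIsogenous W W₀ ∧ ¬ (p : ℤ) ∣ D₀.c := by
  obtain ⟨W₀, hE₀, hM₀, hNe₀, D₀'', hiso, hN, hopt''⟩ := X12.exists_isIsogenous_optimal hnf W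
  haveI := hE₀
  haveI := hM₀
  haveI := hNe₀
  obtain ⟨D₀', hopt'⟩ := X12.exists_optimalDatum_of_level_eq hN D₀'' hopt''
  have hiso₀ : IsIsogenous W₀ W := hiso.symm_of_charZero
  have hL : W₀.LFunction = W.LFunction := hiso₀.LFunction_eq
  have hadd₀ : Addv W₀ p := (X2.addv_iff_of_isIsogenous (p := p) hiso).mp hadd
  have hirr₀ : Irr W₀ p := (X12.irr_iff_of_isIsogenous hiso p).mp hirr
  have hpN : p ^ 2 ∣ W.conductorNorm ℤ := sq_dvd_conductorNorm_of_not_good_of_not_mult hadd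
  have ha : ∀ ℓ ∈ (W.conductorNorm ℤ).primeFactors, ¬ ℓ ^ 2 ∣ W.conductorNorm ℤ →
      W₀.LFunction ℓ = 1 ∨ W₀.LFunction ℓ = -1 := by
    intro ℓ hℓ hℓ2
    haveI : Fact ℓ.Prime := ⟨Nat.prime_of_mem_primeFactors hℓ⟩
    rw [hL]
    rcases hasGoodReductionAtPrime_or_hasMultiplicativeReductionAtPrime_of_not_sq_dvd_conductorNorm (V := W) hℓ2
      with hg | hmul
    · exact absurd (Nat.dvd_of_mem_primeFactors hℓ) (not_dvd_conductorNorm_of_hasGoodReductionAtPrime W hg)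
    · exact KrausOesterle1992.lFunction_apply_prime_eq_one_or_eq_neg_one_of_mult W ℓ hmul
  exact ⟨W₀, hE₀, hM₀, D₀', hiso, not_dvd_c_of_tameTwistL_at W₀ (hK W₀ hiso) D₀' hopt' (by omega) hadd₀ hirr₀ hpN ha⟩

/-- **TDS AT EVERY FRAME, from the tame-twist lever, GRANTED the Kato–Kosters–Pannekoek fact.** At an AKR
residue frame `(W, p)` — `p ≥ 11`, additive, `E[p]` irreducible, newform granted (`hnf`) — and GRANTED the all-characters
Kato–Kosters–Pannekoek fact: for every unstarred (G)-ordinary globally minimal member `V ∼ W` and every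
globally minimal model `W♭` of `V ⊗ χ_{p*}`, SOME conductor-level datum of `V` has strictly fewer factors
`p` in its modular degree than EVERY conductor-level datum of `W♭` — the CONCLUSION of the registered stub
`stub_twistDegreeStep` (Edixhoven 1991 §4, "case 2"), by the predecessor's
`twistDegreeStep_of_exists_member_not_dvd_c` (p540328). Neither the residue clause nor the degree
clause `hall` of the stub is used; K4 is not used. [cite: EdixhovenManin1991, §4 (cases 1/2)]
[cite: Kato2004Asterisque, Thm. 9.7 (p. 189)] -/
theorem twistDegreeStep_of_tameTwistL_at
    (hnf : exists_isNewformOf) (W : WeierstrassCurve ℚ) [W.IsElliptic] [W.IsGloballyMinimal]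
    [NeZero (W.conductorNorm ℤ)] (hp11 : 11 ≤ p) (hadd : Addv W p) (hirr : Irr W p)
    (hK : ∀ (W₀ : WeierstrassCurve ℚ) [W₀.IsElliptic] [W₀.IsGloballyMinimal], IsIsogenous W W₀ →
      ∀ {M : ℕ} [NeZero M] (g : CuspForm (Gamma0 M) 2), IsNewformOf W₀ g → 7 < p →
      ¬ W₀.HasGoodReductionAtPrime p → ¬ W₀.HasMultiplicativeReductionAtPrime p →
      W₀.HasIrreducibleModPGaloisRep p → ∀ (m : ℕ) [NeZero m], m.Coprime (p * M) →
      ∀ (χ : DirichletCharacter ℂ m), χ.IsPrimitive → χ ≠ 1 → ¬ p ∣ orderOf χ → ∀ (ϖ : ℚ) (r : ℂ),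
      (χ.Even → (ϖ : ℝ) * W₀.realPeriodRat = plusPeriod g →
        (∏ ℓ ∈ M.primeFactors with ¬ ℓ ^ 2 ∣ M,
            (((ℓ : ℂ) - (W₀.LFunction ℓ : ℂ) * χ (ℓ : ZMod m)) *
              ((ℓ : ℂ) - (W₀.LFunction ℓ : ℂ) * (χ (ℓ : ZMod m))⁻¹))) *
            twistedSymbolSum g χ = r * (plusPeriod g : ℂ) →
        ∃ s : ℕ, ¬ p ∣ s ∧ IsIntegral ℤ ((s : ℂ) * ϖ * r)) ∧
      (χ.Odd → (ϖ : ℝ) * W₀.imaginaryPeriodRat = minusPeriod g →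
        (∏ ℓ ∈ M.primeFactors with ¬ ℓ ^ 2 ∣ M,
            (((ℓ : ℂ) - (W₀.LFunction ℓ : ℂ) * χ (ℓ : ZMod m)) *
              ((ℓ : ℂ) - (W₀.LFunction ℓ : ℂ) * (χ (ℓ : ZMod m))⁻¹))) *
            twistedSymbolSum g χ = r * (minusPeriod g : ℂ) * Complex.I →
        ∃ s : ℕ, ¬ p ∣ s ∧ IsIntegral ℤ ((s : ℂ) * ϖ * r)))
    (V : WeierstrassCurve ℚ) [V.IsElliptic] [V.IsGloballyMinimal] [NeZero (V.conductorNorm ℤ)]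
    (Wf : WeierstrassCurve ℚ) [Wf.IsElliptic] [Wf.IsGloballyMinimal] [NeZero (Wf.conductorNorm ℤ)]
    (C : VariableChange ℚ) (hisoV : IsIsogenous W V) (hG : TypeGOrd V p)
    (hV4 : padicValInt p V.minimalDiscriminantInt ≤ 4)
    (hC : C • V.quadraticTwist ((-1 : ℚ) ^ (p / 2) * p) = Wf) :
    ∃ D : ModularParametrizationData V (V.conductorNorm ℤ),
      ∀ Df : ModularParametrizationData Wf (Wf.conductorNorm ℤ),
        padicValNat p D.modularDegree < padicValNat p Df.modularDegree :=
  ManinFrameResidueProperTwistDegree.twistDegreeStep_of_exists_member_not_dvd_c hnf W (by omega) hadd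
    hirr hisoV hG hV4 C hC (exists_member_not_dvd_c_of_tameTwistL_at hnf W hp11 hadd hirr hK)

end MainFull

end Summit.BirchSwinnertonDyer.BirchSwinnertonDyer.Theorems.ManinFrameResidueProperRTameTwistAt

end
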